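import Summits.AtomisticToContinuum.FouriersLaw.Theses.EmbeddedDrudeMourre
import Literature.MathematicalPhysics.KineticTheory.InfiniteChainSuperstableDynamics
import Literature.MathematicalPhysics.KineticTheory.InfiniteChainInvariantStates
import HarnessLib

/-!
# Line `heated-measure-thermal-exponent` of crux `EmbeddedDrudeMourre.GreenKuboContinuation`
(stmt-AtomisticToContinuum-12597): what the two modulus stubs K1, K2′ deliver WITHOUT the seam

`--supports` packaging file of the continuation lead c5 (2026-08-16), the analogue for this line of
`EmbeddedDrudeMourreGreenKuboContinuationOfTower.lean` (p108530) for the sibling line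
`temperature-blind-vitali-hurwitz`.

The registered skeleton (`Cruxes/GreenKuboContinuation/Lines/heated-measure-thermal-exponent.lean`)
composes A → B → K1 → K2′ → crux, where B (`stub_seedTransfer`) is the identification SEAM (an
ARBITRARY crux witness at `T₁` must force the physical heated pair to conduct at `T₁`) and K1
(`stub_boundedThermalExponent`: ν-uniform two-sided comparability of the Abel functionals
`A_μ(ν) = ∫₀^∞ e^{-νt} C_μ(t) dt` of two heated states of ONE flow) + K2′
(`stub_thermalExponentConverges`: the ratio `A_μ(ν)/A_{μ'}(ν)` converges as `ν ↓ 0`) carry the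
transport. This file isolates the seam-free content, kernel-checked:

* `tendsto_of_ratio_of_lower_bound` — the real analysis: if `A′(ν) → L′ > 0`, `A/A′ → r` and
  `m·A′ ≤ A` on `(0,1]` with `m > 0`, then `A(ν) → r·L′` with `r ≥ m > 0`;
* `heatedContinuation_of_thermalExponent` — for ONE dynamics `D` of `pinnedChain ω₂ lam β γ` with
  carrier `bmGood` and admissible heated states `μ_T` (the clauses of stub A), K1 ∧ K2′ (as
  hypotheses, verbatim the registered signatures specialised to this `D`) transport a positive
  finite Abel limit from ONE seed temperature `T₁` to EVERY `T > 0` — the heated pair's Abelian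
  Green–Kubo witness at every temperature from a single conducting temperature. No corner interval,
  no arbitrary witness, no seam: this is exactly what the line proves about the canonical pair, and
  it is the retyped crux C′ (c3 `Restatement.lean`, shift-invariant witnesses on both sides)
  restricted to the heated pair, from K1 ∧ K2′ alone.

Nothing here is new mathematics; it records importably that, modulo the planner retype removing B,
the line's whole content is K1 ∧ K2′ (judged crux-sized in `Lines/heated-measure-thermal-exponent-DEAD.md`).
-/

noncomputable section

namespace Summit.AtomisticToContinuum.FouriersLaw.Theorems.GreenKuboContinuation.HeatedMeasureThermalExponent

open MeasureTheory Filter Set Topology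
open Literature.MathematicalPhysics.KineticTheory.HeatConduction

/-- **One-seed transport of a positive limit along a comparable, asymptotically proportional pair.**
If `A′(ν) → L′ > 0` as `ν ↓ 0`, the ratio `A(ν)/A′(ν) → r`, and `m · A′(ν) ≤ A(ν)` for
`ν ∈ (0,1]` with `m > 0`, then `m ≤ r` and `A(ν) → r · L′` (so the limit of `A` exists, is finite
and positive). [folklore] -/
theorem tendsto_of_ratio_of_lower_bound {A A' : ℝ → ℝ} {L' r m : ℝ} (hL' : 0 < L')
    (hA' : Tendsto A' (𝓝[>] (0 : ℝ)) (𝓝 L'))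
    (hr : Tendsto (fun ν : ℝ => A ν / A' ν) (𝓝[>] (0 : ℝ)) (𝓝 r))
    (hm : 0 < m) (hbound : ∀ ν : ℝ, ν ∈ Ioc (0 : ℝ) 1 → m * A' ν ≤ A ν) :
    m ≤ r ∧ 0 < r ∧ Tendsto A (𝓝[>] (0 : ℝ)) (𝓝 (r * L')) := by
  have hpos : ∀ᶠ ν : ℝ in 𝓝[>] (0 : ℝ), 0 < A' ν := hA'.eventually_const_lt hL'
  have hν : ∀ᶠ ν : ℝ in 𝓝[>] (0 : ℝ), ν ∈ Ioc (0 : ℝ) 1 := Ioc_mem_nhdsGT one_pos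
  have hmr : m ≤ r := by
    refine ge_of_tendsto hr ?_
    filter_upwards [hpos, hν] with ν hp hn
    rw [le_div_iff₀ hp]
    exact hbound ν hn
  refine ⟨hmr, lt_of_lt_of_le hm hmr, ?_⟩
  refine (hr.mul hA').congr' ?_
  filter_upwards [hpos] with ν hp
  exact div_mul_cancel₀ _ hp.ne'

/-- **The heated pair conducts at every temperature as soon as it conducts at one** — the seam-free
content of line `heated-measure-thermal-exponent`. Fix `P = pinnedChain ω₂ lam β γ`, ONE dynamics
`D` with `D.carrier = P.bmGood` and, at every `T > 0`, an admissible heated state `μ T` (DLR at `T`,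
shift-invariant, preserved by `D`, absolutely convergent summed current autocorrelation `C_T`,
`C_T` continuous with `|C_T| ≤ C_T(0)` — the clauses of stub A). Assume K1 (ν-uniform comparability
`m · A_{T'}(ν) ≤ A_T(ν)` on `(0,1]`, `m = m(T,T') > 0`) and K2′ (convergence of `A_T(ν)/A_{T'}(ν)` as
`ν ↓ 0`) for this `D` and these states — verbatim the registered stub signatures specialised to `D`.
If at ONE temperature `T₁ > 0` the heated pair is an Abelian Green–Kubo witness
(`T₁⁻² A_{T₁}(ν) → κ₁ > 0`), then it is one at EVERY `T > 0`. [folklore] -/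
theorem heatedContinuation_of_thermalExponent :
    ∀ {ω₂ lam β γ : ℝ} (D : InfiniteChainDynamics (pinnedChain ω₂ lam β γ)) (μ : ℝ → Measure ChainConfig), (∀ T : ℝ, 0 < T → (pinnedChain ω₂ lam β γ).IsChainGibbsMeasure T (μ T) ∧ IsShiftInvariant (μ T) ∧ D.PreservesMeasure (μ T) ∧ (∀ t : ℝ, D.HasAbsConvergentCorrelation (μ T) t) ∧ Continuous (D.currentCorrelation (μ T)) ∧ ∀ t : ℝ, |D.currentCorrelation (μ T) t| ≤ D.currentCorrelation (μ T) 0) → (∀ T T' : ℝ, 0 < T → 0 < T' → ∀ μ₀ μ₀' : Measure ChainConfig, ((pinnedChain ω₂ lam β γ).IsChainGibbsMeasure T μ₀ ∧ IsShiftInvariant μ₀ ∧ D.PreservesMeasure μ₀ ∧ (∀ t : ℝ, D.HasAbsConvergentCorrelation μ₀ t) ∧ Continuous (D.currentCorrelation μ₀) ∧ ∀ t : ℝ, |D.currentCorrelation μ₀ t| ≤ D.currentCorrelation μ₀ 0) → ((pinnedChain ω₂ lam β γ).IsChainGibbsMeasure T' μ₀' ∧ IsShiftInvariant μ₀' ∧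 D.PreservesMeasure μ₀' ∧ (∀ t : ℝ, D.HasAbsConvergentCorrelation μ₀' t) ∧ Continuous (D.currentCorrelation μ₀') ∧ ∀ t : ℝ, |D.currentCorrelation μ₀' t| ≤ D.currentCorrelation μ₀' 0) → ∃ m : ℝ, 0 < m ∧ ∀ ν : ℝ, ν ∈ Ioc (0 : ℝ) 1 → m * (∫ t in Ioi (0 : ℝ), Real.exp (-(ν * t)) * D.currentCorrelation μ₀' t) ≤ ∫ t in Ioi (0 : ℝ), Real.exp (-(ν * t)) * D.currentCorrelation μ₀ t) → (∀ T T' : ℝ, 0 < T → 0 < T' → ∀ μ₀ μ₀' : Measure ChainConfig, ((pinnedChain ω₂ lam β γ).IsChainGibbsMeasure T μ₀ ∧ IsShiftInvariant μ₀ ∧ D.PreservesMeasure μ₀ ∧ (∀ t : ℝ, D.HasAbsConvergentCorrelation μ₀ t) ∧ Continuous (D.currentCorrelation μ₀) ∧ ∀ t : ℝ, |D.currentCorrelation μ₀ t| ≤ D.currentCorrelation μ₀ 0) → ((pinnedChain ω₂ lam β γ).IsChainGibbsMeasure T' μ₀' ∧ IsShiftInvariant μ₀' ∧ D.PreservesMeasure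 μ₀' ∧ (∀ t : ℝ, D.HasAbsConvergentCorrelation μ₀' t) ∧ Continuous (D.currentCorrelation μ₀') ∧ ∀ t : ℝ, |D.currentCorrelation μ₀' t| ≤ D.currentCorrelation μ₀' 0) → ∃ r : ℝ, Tendsto (fun ν : ℝ => (∫ t in Ioi (0 : ℝ), Real.exp (-(ν * t)) * D.currentCorrelation μ₀ t) / ∫ t in Ioi (0 : ℝ), Real.exp (-(ν * t)) * D.currentCorrelation μ₀' t) (𝓝[>] (0 : ℝ)) (𝓝 r)) → ∀ {T₁ : ℝ}, 0 < T₁ → (∃ κ₁ : ℝ, 0 < κ₁ ∧ Tendsto (fun ν : ℝ => (T₁ ^ 2)⁻¹ * ∫ t in Ioi (0 : ℝ), Real.exp (-(ν * t)) * D.currentCorrelation (μ T₁) t) (𝓝[>] (0 : ℝ)) (𝓝 κ₁)) → ∀ T : ℝ, 0 < T → ∃ κ : ℝ, 0 < κ ∧ Tendsto (fun ν : ℝ => (T ^ 2)⁻¹ * ∫ t in Ioi (0 : ℝ), Real.exp (-(ν * t)) * D.currentCorrelation (μ T) t) (𝓝[>] (0 : ℝ)) (𝓝 κ) := by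
  intro ω₂ lam β γ D μ hμ hK1 hK2 T₁ hT₁ hseed T hT
  obtain ⟨κ₁, hκ₁, hlim₁⟩ := hseed
  have hT₁sq : (0 : ℝ) < T₁ ^ 2 := by positivity
  -- the seed Abel functional tends to L₁ := T₁² κ₁ > 0
  have hA₁ : Tendsto (fun ν : ℝ => ∫ t in Ioi (0 : ℝ),
      Real.exp (-(ν * t)) * D.currentCorrelation (μ T₁) t) (𝓝[>] (0 : ℝ)) (𝓝 (T₁ ^ 2 * κ₁)) := by
    refine (hlim₁.const_mul (T₁ ^ 2)).congr' (Eventually.of_forall fun ν => ?_)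
    simp only
    rw [← mul_assoc, mul_inv_cancel₀ hT₁sq.ne', one_mul]
  obtain ⟨m, hm, hbound⟩ := hK1 T T₁ hT hT₁ (μ T) (μ T₁) (hμ T hT) (hμ T₁ hT₁)
  obtain ⟨r, hr⟩ := hK2 T T₁ hT hT₁ (μ T) (μ T₁) (hμ T hT) (hμ T₁ hT₁)
  obtain ⟨-, hrpos, hAT⟩ :=
    tendsto_of_ratio_of_lower_bound (mul_pos hT₁sq hκ₁) hA₁ hr hm hbound
  exact ⟨(T ^ 2)⁻¹ * (r * (T₁ ^ 2 * κ₁)),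
    mul_pos (inv_pos.mpr (pow_pos hT 2)) (mul_pos hrpos (mul_pos hT₁sq hκ₁)),
    hAT.const_mul ((T ^ 2)⁻¹)⟩

end Summit.AtomisticToContinuum.FouriersLaw.Theorems.GreenKuboContinuation.HeatedMeasureThermalExponent

end
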